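import Mathlib

/-!
# S5Plate — kernel plate for memo `READING2-S5-TRANSFER-g17.md` (transfer lens g17; PEN + typing only)

Token: line stmt-HodgeConjecture-18881 Cruxes/BlochSeedDiscOne/Lines/birth.lean 814a6a70c14e831a stub_rung_pad4_seedAt.
HC ∕ HC_CM (HELD, displayed binder only) ∕ HC_AV ∕ 18881 ∕ 30548 ∕ H2 are NOT proved or touched here; width toward H2 = 0.
Nothing below is a statement about sheaves or cycles on an abelian fourfold.  The GEOMETRY of the memo (LEMMA δ,
THEOREM Z ∕ F ∕ R, COROLLARY T_x, THEOREM L, PROPOSITION D4-T_x) is PEN (×1, submitted for audit); what is kernel-checked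
here is the finite ∕ linear-algebra bookkeeping the pen proofs lean on:

* §1 `trio_pigeonhole` — the combinatorial step of THEOREM L (L2)(v): six curves in three classes `k, l, m` (two per class,
  partners have exchanged Gauss kernels `K ↔ K'`); if for the ordered pairs (m₀ ; k-class), (k₀ ; l-class), (k₁ ; l-class) the
  kernel of the first curve is one of the two kernels over the second class, then three curves over the three distinct
  classes share one kernel — which (L2)(v) excludes geometrically.  Contrapositive = «some ordered pair (i, j) over distinct
  classes has K_i ∉ {K_j, K'_j}».  Pure logic over an arbitrary type of labels.
* §2 `two_pencils_span_three` — the Grassmann count of (L1)∕(L3): two 2-dimensional subspaces (the pencils P₁, P₂ inside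
  `H⁰(A')`) meeting in dimension ≤ 1 span dimension ≥ 3; and `= 4 − e` in general (`Submodule.finrank_sup_add_finrank_inf_eq`).
* §3 `s5_numerology` — the integer bookkeeping quoted verbatim in the memo: Riemann–Roch on `S = Θ ∩ Θ_x`
  (`χ(𝒪_S) = 14`, `θ|² = 24`, `λ·θ| = 8`, `λ² = 0`, meeting classes `λ·λ' = 4`, so `A'² = 16`, `A'·K_S = 48`, `χ(A') = −2`,
  and `h¹ = h⁰ + h² + 2 ≥ 8` when `h⁰, h² ≥ 3`), the parity count of (L2)(i)(iii) (`1 + 2 = 3` odd, Gauss kernel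
  `4 − 2 = 2`, Clifford `2·(3−1) ≤ 4` is the equality case), (L4)(c) (`8 − 2 = 6`, `4 + k ∈ {6,7}` for `2 ≤ k ≤ 3`),
  degrees in LEMMA δ ∕ THEOREM Z (`deg M = 8`, `deg N = 8 − 8 − 0 = 0`, `deg Z̃ = 4`, `2·4 = 8 = 2g(C) − 2` for `g = 5`).
* later sections (v1.1–v1.4): THEOREM T bookkeeping (K₄), (L10) Heisenberg parity, (L12) THEOREM E 𝔽₂ census
  (`s5_theoremE_count`: 528 ∕ 495 ∕ 255 ∕ 240 by `decide`), (L13) THEOREM N restriction count, and — v1.4 — (L15)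
  THEOREM Γ: the polynomial identities of Cayley's 4-nodal cubic (`s5_cayley_identities`, `ring`), the face relations
  (`s5_face_relations`, `omega`), the numerology `27 = 3·1 + 6·4`, `1485 = 3·495`, `495 = 2⁴(2⁵−1) − 1`, and the
  group orders of (L16) PROPOSITION E9′ (`s5_E9prime_orders`); v1.5 — (L17) THEOREM Σ: the orders
  `|O⁻₁₀(2)| = 495·2⁸·|O⁻₈(2)|`, `|O⁻₈(2)| = 2·|Ω⁻₈(2)|`, `272 = 2(2⁷+2³)` (`s5_sigma_orders`).
  The Gauss map, `deg α = 6`, the count 495 and the monodromy theorems are pen + print.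
-/

namespace H21Scratch.TransferS5Plate

section Pigeonhole

/-- THEOREM L (L2)(v), combinatorial core.  Labels `Kk0 Kk1` (class k), `Kl0 Kl1` (class l), `Km0` (one curve of class m)
are the Gauss kernels; each hypothesis says «the kernel of this curve is one of the two kernels over that class».
Conclusion: a kernel common to one curve of each of the three classes. -/
theorem trio_pigeonhole {α : Type*} {Kk0 Kk1 Kl0 Kl1 Km0 : α}
    (hm0 : Km0 = Kk0 ∨ Km0 = Kk1) (hk0 : Kk0 = Kl0 ∨ Kk0 = Kl1) (hk1 : Kk1 = Kl0 ∨ Kk1 = Kl1) :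
    ∃ a b : α, (a = Kk0 ∨ a = Kk1) ∧ (b = Kl0 ∨ b = Kl1) ∧ Km0 = a ∧ a = b := by
  rcases hm0 with h | h
  · rcases hk0 with h' | h'
    · exact ⟨Kk0, Kl0, Or.inl rfl, Or.inl rfl, h, h'⟩
    · exact ⟨Kk0, Kl1, Or.inl rfl, Or.inr rfl, h, h'⟩
  · rcases hk1 with h' | h'
    · exact ⟨Kk1, Kl0, Or.inr rfl, Or.inl rfl, h, h'⟩
    · exact ⟨Kk1, Kl1, Or.inr rfl, Or.inr rfl, h, h'⟩

/-- Contrapositive form used in the memo: if NO kernel is common to curves of all three classes, then one of the three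
ordered pairs has its first kernel outside the two kernels of the second class. -/
theorem trio_pigeonhole' {α : Type*} {Kk0 Kk1 Kl0 Kl1 Km0 : α}
    (hno : ∀ a b : α, (a = Kk0 ∨ a = Kk1) → (b = Kl0 ∨ b = Kl1) → Km0 = a → a ≠ b) :
    ¬ (Km0 = Kk0 ∨ Km0 = Kk1) ∨ ¬ (Kk0 = Kl0 ∨ Kk0 = Kl1) ∨ ¬ (Kk1 = Kl0 ∨ Kk1 = Kl1) := by
  by_cases hm0 : (Km0 = Kk0 ∨ Km0 = Kk1)
  · by_cases hk0 : (Kk0 = Kl0 ∨ Kk0 = Kl1)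
    · by_cases hk1 : (Kk1 = Kl0 ∨ Kk1 = Kl1)
      · obtain ⟨a, b, ha, hb, hma, hab⟩ := trio_pigeonhole hm0 hk0 hk1
        exact absurd hab (hno a b ha hb hma)
      · exact Or.inr (Or.inr hk1)
    · exact Or.inr (Or.inl hk0)
  · exact Or.inl hm0

end Pigeonhole

section Grassmann

variable {K V : Type*} [DivisionRing K] [AddCommGroup V] [Module K V]

/-- (L1)∕(L3): two pencils (2-planes of sections) meeting in dimension `e` span `4 − e`. -/
theorem two_pencils_span (U₁ U₂ : Submodule K V) [FiniteDimensional K U₁] [FiniteDimensional K U₂]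
    (h1 : Module.finrank K U₁ = 2) (h2 : Module.finrank K U₂ = 2) :
    Module.finrank K ↥(U₁ ⊔ U₂) = 4 - Module.finrank K ↥(U₁ ⊓ U₂) := by
  have := Submodule.finrank_sup_add_finrank_inf_eq U₁ U₂
  omega

/-- (L3): if the two pencils meet in dimension ≤ 1 (K_i ≠ K'_j), then `h⁰(A') ≥ 3`. -/
theorem two_pencils_span_three (U₁ U₂ : Submodule K V) [FiniteDimensional K U₁] [FiniteDimensional K U₂]
    (h1 : Module.finrank K U₁ = 2) (h2 : Module.finrank K U₂ = 2) (h : Module.finrank K ↥(U₁ ⊓ U₂) ≤ 1) :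
    3 ≤ Module.finrank K ↥(U₁ ⊔ U₂) := by
  have := Submodule.finrank_sup_add_finrank_inf_eq U₁ U₂
  omega

/-- (L4)(c): two 4-dimensional spaces of sections (`1_{C̃_i}·H⁰(𝒪_S(Θ_x))` and `1_{σ_x C̃_i}·H⁰(𝒪_S(Θ))`) meeting in the
2-dimensional `K'_{σ_x i} = K_i` span dimension `6`. -/
theorem two_webs_span_six (U₁ U₂ : Submodule K V) [FiniteDimensional K U₁] [FiniteDimensional K U₂]
    (h1 : Module.finrank K U₁ = 4) (h2 : Module.finrank K U₂ = 4) (h : Module.finrank K ↥(U₁ ⊓ U₂) = 2) :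
    Module.finrank K ↥(U₁ ⊔ U₂) = 6 := by
  have := Submodule.finrank_sup_add_finrank_inf_eq U₁ U₂
  omega

end Grassmann

section Numerology

/-- Integer bookkeeping quoted in the memo (see the module docstring for which line uses which conjunct). -/
theorem s5_numerology :
    -- Riemann–Roch on S = Θ ∩ Θ_x ⊂ X (ppav₄): χ(𝒪_S) = χ(𝒪_X) − χ(𝒪(−Θ)) − χ(𝒪(−Θ_x)) + χ(𝒪(−Θ−Θ_x)) = 0 − 1 − 1 + 16
    ((0 : ℤ) - 1 - 1 + 2 ^ 4 = 14) ∧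
    -- θ|_S² = θ⁴/… = 4! = 24 ; A' ≡ θ| + λ_k − λ_l with λ² = 0, λ·θ| = 8, λ_k·λ_l = 4 :
    (Nat.factorial 4 = 24) ∧
    ((24 : ℤ) + 2 * (8 - 8) + (0 - 2 * 4 + 0) = 16) ∧          -- A'²
    ((2 : ℤ) * (24 + 8 - 8) = 48) ∧                              -- A'·K_S, K_S = 2θ|_S
    ((14 : ℤ) + (16 - 48) / 2 = -2) ∧                            -- χ(A') = −2
    (∀ h0 h2 : ℕ, 3 ≤ h0 → 3 ≤ h2 → 8 ≤ h0 + h2 + 2) ∧           -- h¹ = h⁰ + h² − χ ≥ 8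
    -- (L2)(i)(iii): h⁰(π*κ) = 1 + 2 odd; Gauss kernel 4 − 2 = 2; Clifford bound 2(r−1) ≤ d at r = 3, d = 4 is equality
    (1 + 2 = 3 ∧ ¬ 2 ∣ 3 ∧ 4 - 2 = 2 ∧ 2 * (3 - 1) = 4) ∧
    -- (L1)/(L3): 2 + 2 − 1 = 3, 2 + 2 − 0 = 4 ; (L4)(c): 8 − 2 = 6 and 4 + k ∈ {6, 7} for 2 ≤ k ≤ 3
    (2 + 2 - 1 = 3 ∧ 2 + 2 - 0 = 4 ∧ 8 - 2 = 6 ∧ ∀ k : ℕ, 2 ≤ k → k ≤ 3 → (4 + k = 6 ∨ 4 + k = 7)) ∧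
    -- LEMMA δ / THEOREM Z degrees: g(C) = 5, g(C̃) = 9, deg K_C = 8 = deg M, deg N = 8 − 8 − 0 = 0 = λ², deg Z̃ = λ_k·λ_l = 4,
    -- deg D_v = g − 1 = 4 = 2 + 2 (p₁ + p₂ + a + b), 2·deg D_v = deg K_C
    (2 * 5 - 2 = 8 ∧ 2 * 9 - 2 = 16 ∧ (8 : ℤ) - 8 - 0 = 0 ∧ 5 - 1 = 4 ∧ 2 + 2 = 4 ∧ 2 * 4 = 8) := by
  refine ⟨by norm_num, by decide, by norm_num, by norm_num, by norm_num, fun h0 h2 hh0 hh2 => by omega,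
    ⟨by decide, by decide, by decide, by decide⟩, ⟨by decide, by decide, by decide, fun k hk hk' => by omega⟩,
    ⟨by decide, by decide, by norm_num, by decide, by decide, by decide⟩⟩

end Numerology

/-! ## v1.1 — THEOREM T (tetrahedron) bookkeeping
The six (−1)-stable Prym curves over the trio `T_x` are labelled by the six edges of `K₄` (2-subsets of
`Fin 4`), encoded as `Fin 6`: `0={0,1}, 1={0,2}, 2={0,3}, 3={1,2}, 4={1,3}, 5={2,3}`; opposite edges
(same class, disjoint curves) are exactly the index pairs summing to `5`; adjacent edges (distinct
classes) meet in `4` points; self-intersection `0`.  `inc e s` says vertex `s` lies on edge `e`.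
`Star s` = edges through `s` (divisor of `∂_{v_s}θ` on `S`), `Face s` = edges missing `s`
(divisor of `∂_{v_s}θ_x` on `S`).  The theorem checks: each star/face has 3 edges, one per class;
star ∪ face = all six; `Star(s)·Star(t) = 24 = θ|²`, `Star(s)·Face(t) = 24`; each edge is adjacent
to exactly 4 others (incidence `K_{2,2,2}`); base points of the residual pencil `(θ| − λ)² = 8`;
`χ(𝒪_S(Θ − 2C̃)) = 2`; 24 ordered adjacent pairs; 48 cross-intersection points, 12 over each `H_w`. -/
section Tetra

/-- vertex `s : Fin 4` lies on edge `e : Fin 6` -/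
def inc (e : Fin 6) (s : Fin 4) : Bool :=
  match e.val, s.val with
  | 0, 0 => true | 0, 1 => true
  | 1, 0 => true | 1, 2 => true
  | 2, 0 => true | 2, 3 => true
  | 3, 1 => true | 3, 2 => true
  | 4, 1 => true | 4, 3 => true
  | 5, 2 => true | 5, 3 => true
  | _, _ => false

/-- intersection number of the curves labelled `e`, `f` on `S = Θ ∩ Θ_x` -/
def I6 (e f : Fin 6) : ℕ := if e = f ∨ e.val + f.val = 5 then 0 else 4

/-- class of an edge: opposite edges share a class (`min (e, 5 - e)`) -/
def cls (e : Fin 6) : ℕ := min e.val (5 - e.val)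

def starSum (s t : Fin 4) : ℕ :=
  ((List.finRange 6).map fun e => ((List.finRange 6).map fun f =>
    if inc e s && inc f t then I6 e f else 0).sum).sum

def starFaceSum (s t : Fin 4) : ℕ :=
  ((List.finRange 6).map fun e => ((List.finRange 6).map fun f =>
    if inc e s && !(inc f t) then I6 e f else 0).sum).sum

theorem k4_edge_facts :
    -- three edges through each vertex, three in each opposite face, and they partition the six
    (∀ s : Fin 4, ((List.finRange 6).filter fun e => inc e s).length = 3) ∧
    (∀ s : Fin 4, ((List.finRange 6).filter fun e => !(inc e s)).length = 3) ∧
    -- the three edges at a vertex lie over the three distinct classes (one per class), same for a face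
    (∀ s : Fin 4, ∀ e f : Fin 6, inc e s = true → inc f s = true → e ≠ f → cls e ≠ cls f) ∧
    (∀ s : Fin 4, ∀ e f : Fin 6, inc e s = false → inc f s = false → e ≠ f → cls e ≠ cls f) ∧
    -- opposite edges = same class = disjoint index sets; adjacent = share exactly one vertex
    (∀ e f : Fin 6, e ≠ f → (cls e = cls f ↔ e.val + f.val = 5)) ∧
    (∀ e f : Fin 6, e.val + f.val = 5 → ∀ s : Fin 4, ¬ (inc e s = true ∧ inc f s = true)) ∧
    -- each edge is adjacent to exactly four others (octahedral incidence K_{2,2,2})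
    (∀ e : Fin 6, ((List.finRange 6).filter fun f => decide (I6 e f = 4)).length = 4) ∧
    -- 24 ordered adjacent pairs; 48 cross-intersection points = 12 adjacent unordered pairs × 4
    (((List.finRange 6).map fun e => ((List.finRange 6).filter fun f => decide (I6 e f = 4)).length).sum = 24) ∧
    12 * 4 = 48 ∧ 4 * 12 = 48 := by
  refine ⟨by decide, by decide, by decide, by decide, by decide, by decide, by decide, by decide, by norm_num, by norm_num⟩

theorem s5_tetra_numerology :
    -- Star(s)·Star(t) = 24 = θ|² for all s, t (incl. s = t); Star(s)·Face(t) = 24 for all s, t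
    (∀ s t : Fin 4, starSum s t = 24) ∧ (∀ s t : Fin 4, starFaceSum s t = 24) ∧
    -- θ|² = 24, θ|·λ = 8, λ² = 0, adjacent λ·λ' = 4: (θ − λ)² = 24 − 16 + 0 = 8 base points of the residual pencil
    (24 - 2 * 8 + 0 = 8) ∧ (4 + 4 = 8) ∧
    -- χ(𝒪_S(Θ − 2C̃)) = χ(𝒪_S) + (D² − D·K_S)/2 with D² = 24 − 32 = −8, D·K_S = 2·(24 − 16) = 16
    ((14 : ℤ) + ((24 - 4 * 8) - 2 * (24 - 2 * 8)) / 2 = 2) ∧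
    -- a full fibre of the degree-8 map γ|_{C̃_e}: two Z̃'s of 4 points each; deg γ_Θ = 4! = 24 ≥ 12
    (4 + 4 = 8) ∧ (Nat.factorial 4 = 24) ∧ (12 ≤ 24) ∧
    -- Grassmann: two distinct 2-planes inside a 3-space meet in a line: 2 + 2 − 3 = 1
    (2 + 2 - 3 = 1) ∧
    -- A'² = (θ + λ_i − λ_j)² = 24 + 2·8 − 2·8 + 0 + 0 − 2·4 = 16 = z of R2-12 (D4); 6 curves × 4 adjacent = 24 ordered pairs
    ((24 : ℤ) + 2 * 8 - 2 * 8 + 0 + 0 - 2 * 4 = 16) ∧ (6 * 4 = 24) := by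
  refine ⟨by decide, by decide, by norm_num, by norm_num, by norm_num, by norm_num, by decide, by norm_num,
    by norm_num, by norm_num, by norm_num⟩

/-- v1.2 (L9)(iv): for every edge `e` of K₄ the four edges ADJACENT to `e` (neither `e` nor its
opposite) form a skew quadrilateral: every vertex lies on exactly two of them; and the two edges
adjacent to `e = st` through the vertex `s` are the other two edges of `Star(s)`. -/
theorem k4_adjacent_quadrilateral :
    (∀ e : Fin 6, ∀ s : Fin 4,
      ((List.finRange 6).filter fun f => decide (f ≠ e ∧ f.val + e.val ≠ 5 ∧ inc f s = true)).length = 2) ∧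
    -- the 8 marked points of Γ_e on the quadrilateral: 4 adjacent edges × 2 points; Γ_e·Q = 2·8 = 16
    (4 * 2 = 8) ∧ (2 * 8 = 16) := by
  refine ⟨by decide, by norm_num, by norm_num⟩

/-- v1.2 (L10) HEISENBERG PARITY COUNT (the arithmetic skeleton; the linear algebra is pen):
`V = H⁰(𝒪_X(Θ + Θ_x))` has dimension 16 = 8 + 8 (eigenspaces of `τ_x^*`); the flag
`⟨s₀⟩ ⊂ F₁ ⊂ T²` has graded dimensions `1, 4, d` with signs `ε, −ε, ε`, so `1 + d ≤ 8`;
hence `d ≤ 7`, `dim T² = 5 + d ≤ 12`, and the net of relations has `dim N = 10 − d ≥ 3`;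
`dim F₁ = h⁰(I_S(Θ + Θ_x)) = 2 − 1 + 4 = 5`; THEOREM T supplies `4 − 1 = 3` diagonal relations,
the parity minimum, leaving `6 + 1 = 7` for the off-diagonal products and `Q₁₁`. -/
theorem s5_heisenberg_count :
    (16 = 8 + 8) ∧ (2 - 1 + 4 = 5) ∧ (1 + 4 + 10 = 15) ∧
    (∀ d : ℕ, 1 + d ≤ 8 → d ≤ 7 ∧ 5 + d ≤ 12 ∧ 3 ≤ 10 - d) ∧
    (4 - 1 = 3) ∧ (1 + 10 - 8 = 3) ∧ (15 - 12 = 3) ∧ (6 + 1 = 7) ∧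
    -- g = 2, 3 sanity: the same count gives d ≤ 2 − 1 = 1 (vacuous in ℙ³) and d ≤ 4 − 1 = 3 (T² ≤ 7 < 8)
    (2 - 1 = 1) ∧ (4 - 1 = 3) ∧ (1 + 3 + 3 = 7) := by
  refine ⟨by norm_num, by norm_num, by norm_num, ?_, by norm_num, by norm_num, by norm_num, by norm_num,
    by norm_num, by norm_num, by norm_num⟩
  intro d hd
  omega

end Tetra


/-! ### v1.3 (L12) THEOREM E — the 𝔽₂ bookkeeping, certified (the geometry is pen + print)
Vectors of `𝔽₂¹⁰ = JV₂` are coded by `n < 1024` (bit `i` = coordinate `i`). `qf` is a quadratic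
form of Arf invariant 1 (four hyperbolic planes and the anisotropic plane `x₈² + x₈x₉ + x₉²`), a
model of `Q_{κ_V}`, κ_V the odd canonical theta-characteristic of the cubic threefold (Donagi's
parity is `q = 1 + Q`); `ef` is its polar symplectic form; `del = e₈` is a Donagi-EVEN semiperiod
(`qf del = true`). Certified: |{Q = 1}| = 528, |{Q = 0} ∖ 0| = 495, and for the even `δ`:
|{ε ≠ 0 : Q ε = 0, e(δ, ε) = 0}| = 255 («straight» nodes per triple), |{Q ε = 0, e(δ, ε) = 1}| = 240;
every class of `δ^⊥/δ` has exactly one Q-odd lift ((E9)); and the arithmetic 1485 = 3·495 (forced),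
765 = 3·255 = 255·3, 720 = 3·240, 495·272 = 528·255 (double count). -/
section TheoremE

def bt (n i : ℕ) : Bool := n.testBit i

/-- `Q(x) = x₀x₁ + x₂x₃ + x₄x₅ + x₆x₇ + x₈² + x₈x₉ + x₉²` on `𝔽₂¹⁰` (Arf invariant 1). -/
def qf (n : ℕ) : Bool :=
  (bt n 0 && bt n 1) ^^ (bt n 2 && bt n 3) ^^ (bt n 4 && bt n 5) ^^ (bt n 6 && bt n 7) ^^
    bt n 8 ^^ (bt n 8 && bt n 9) ^^ bt n 9

/-- polar form `e(m, n) = Q(m + n) + Q(m) + Q(n)`. -/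
def ef (m n : ℕ) : Bool := qf (m ^^^ n) ^^ qf m ^^ qf n

/-- the even semiperiod `δ = e₈`. -/
def del : ℕ := 256

/-- `cnt2 p k a = #{n ∈ [a, a + 2^k) : p n}` by binary splitting (recursion depth `k`,
kernel-evaluable by `decide`); `all2 p k a` = `p` holds on the whole block. -/
def cnt2 (p : ℕ → Bool) : ℕ → ℕ → ℕ
  | 0, a => if p a then 1 else 0
  | k + 1, a => cnt2 p k a + cnt2 p k (a + 2 ^ k)

def all2 (p : ℕ → Bool) : ℕ → ℕ → Bool
  | 0, a => p a
  | k + 1, a => all2 p k a && all2 p k (a + 2 ^ k)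

set_option maxRecDepth 8192 in
set_option maxHeartbeats 4000000 in
theorem s5_theoremE_count :
    -- calibration: the block [0, 1024) has 1024 members; δ is even (Q δ = 1)
    cnt2 (fun _ => true) 10 0 = 1024 ∧ qf del = true ∧
    cnt2 (fun n => qf n) 10 0 = 528 ∧
    cnt2 (fun n => !qf n && n != 0) 10 0 = 495 ∧
    cnt2 (fun n => !qf n && n != 0 && !ef del n) 10 0 = 255 ∧
    cnt2 (fun n => !qf n && ef del n) 10 0 = 240 ∧
    cnt2 (fun n => qf n && !ef del n) 10 0 = 256 ∧
    cnt2 (fun n => qf n && ef del n) 10 0 = 272 ∧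
    -- (E9): orthogonally to δ, the two lifts ε, ε + δ of a class of δ^⊥/δ have opposite Q-values
    all2 (fun n => ef del n || (qf (n ^^^ del) == !qf n)) 10 0 = true := by
  refine ⟨by decide, by decide, by decide, by decide, by decide, by decide, by decide, by decide, by decide⟩

theorem s5_theoremE_arith :
    (2 ^ 9 + 2 ^ 4 = 528) ∧ (2 ^ 9 - 2 ^ 4 - 1 = 495) ∧ (528 + 495 + 1 = 1024) ∧ (2 ^ 8 - 1 = 255) ∧
    -- LNR's 1485 nodes decompose over the two monodromy orbits 495 ∕ 528 in exactly one way
    (∀ a b : ℕ, 495 * a + 528 * b = 1485 → a = 3 ∧ b = 0) ∧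
    (3 * 255 = 765) ∧ (3 * 240 = 720) ∧ (765 + 720 = 1485) ∧ (255 + 240 = 495) ∧
    -- double count of pairs (δ, ε): Q δ = 1, Q ε = 0, ε ≠ 0, e = 0; 272 = 2·(2⁷ + 2³) = |{Q = 1} ∩ ε^⊥|
    (2 * (2 ^ 7 + 2 ^ 3) = 272) ∧ (495 * 272 = 528 * 255) ∧
    -- equidistribution over |A[2] ∖ 0| = 255: k = 3 σ_x-pairs per x; orbit count 54 = 3·2 + 12·4
    (765 = 255 * 3) ∧ (54 = 3 * 2 + 12 * 4) ∧ (720 % 255 ≠ 0) ∧ (1485 % 255 ≠ 0) := by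
  refine ⟨by norm_num, by norm_num, by norm_num, by norm_num, ?_, by norm_num, by norm_num, by norm_num,
    by norm_num, by norm_num, by norm_num, by norm_num, by norm_num, by norm_num, by norm_num⟩
  intro a b h
  omega

end TheoremE

/-! ### v1.3 (L13) THEOREM N — the restriction bookkeeping, certified on the K₄ model
On the curve `C̃_e` all diagonal products and the two products indexed by `e` and its opposite
vanish; the surviving four are indexed by the edges ADJACENT to `e`; two adjacent curves
`e₀ = 0, e₁ = 1` already see all six off-diagonal products (so all `b_f = 0`), and
`dim T² = 1 + 4 + 7 = 12 = 15 − 3`; the even part of the osculating flag stops at order 2. -/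
section TheoremN

theorem s5_theoremN_count :
    (∀ f : Fin 6, I6 0 f = 4 ∨ I6 1 f = 4) ∧
    (∀ e : Fin 6, ((List.finRange 6).filter fun f => decide (I6 e f = 4)).length = 4) ∧
    (1 + 4 + 7 = 12) ∧ (15 - 3 = 12) ∧ (10 - 7 = 3) ∧ (7 - 7 = 0) ∧ (8 - 4 = 4) ∧
    -- Veronese count: planes in ℙ⁹ = ℙ(Sym² T₀X): dim Gr(3,10) = 21; planes inside a 4-secant ℙ³ of v₂(ℙ³): 4·3 + 3 = 15; codim 6
    (3 * (10 - 3) = 21) ∧ (4 * 3 + 3 = 15) ∧ (21 - 15 = 6) := by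
  refine ⟨by decide, by decide, by norm_num, by norm_num, by norm_num, by norm_num, by norm_num,
    by norm_num, by norm_num, by norm_num⟩

end TheoremN

/-! ## (L15) THEOREM Γ — the Cayley cubic surface (v1.4)
Polynomial identities for Cayley's 4-nodal cubic `F = x₀x₁x₂ + x₀x₁x₃ + x₀x₂x₃ + x₁x₂x₃`
(nodes at the coordinate points): the nine lines lie on it, the plane `x₂ + x₃ = 0` cuts
`2·e₀₁ + l₀₁|₂₃`, a face cuts three edges, the residual conic in the pencil through an edge,
the singular points on an edge, and the ℤ-linear «face relations» behind `ε₁ = ε₂ = ε₃`;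
plus the v1.4 numerology. Geometry (Gauss map, `deg α = 6`, the count 495) is pen + print. -/
section TheoremGamma

/-- Cayley's cubic. -/
def cayF (x0 x1 x2 x3 : ℤ) : ℤ := x0 * x1 * x2 + x0 * x1 * x3 + x0 * x2 * x3 + x1 * x2 * x3

/-- its four partial derivatives. -/
def cayD0 (_ x1 x2 x3 : ℤ) : ℤ := x1 * x2 + x1 * x3 + x2 * x3
def cayD1 (x0 _ x2 x3 : ℤ) : ℤ := x0 * x2 + x0 * x3 + x2 * x3
def cayD2 (x0 x1 _ x3 : ℤ) : ℤ := x0 * x1 + x0 * x3 + x1 * x3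
def cayD3 (x0 x1 x2 _ : ℤ) : ℤ := x0 * x1 + x0 * x2 + x1 * x2

theorem s5_cayley_identities :
    -- the six edges e_{st} = {x_u = x_v = 0} lie on F
    (∀ s t : ℤ, cayF s t 0 0 = 0 ∧ cayF s 0 t 0 = 0 ∧ cayF s 0 0 t = 0 ∧
        cayF 0 s t 0 = 0 ∧ cayF 0 s 0 t = 0 ∧ cayF 0 0 s t = 0) ∧
    -- the three simple lines l₀₁|₂₃, l₀₂|₁₃, l₀₃|₁₂ lie on F (and in the plane Σ xᵢ = 0)
    (∀ s t : ℤ, cayF s (-s) t (-t) = 0 ∧ cayF s t (-s) (-t) = 0 ∧ cayF s t (-t) (-s) = 0 ∧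
        s + (-s) + t + (-t) = 0) ∧
    -- the plane x₃ = -x₂ through e₀₁ = {x₂ = x₃ = 0}: F| = -x₂²·(x₀ + x₁), i.e. 2·e₀₁ + l₀₁|₂₃
    (∀ x0 x1 x2 : ℤ, cayF x0 x1 x2 (-x2) = -(x2 ^ 2 * (x0 + x1))) ∧
    -- the face x₃ = 0 cuts the three edges e₀₁ + e₀₂ + e₁₂ (x₂ = 0, x₁ = 0, x₀ = 0 in the face)
    (∀ x0 x1 x2 : ℤ, cayF x0 x1 x2 0 = x0 * x1 * x2) ∧
    -- pencil x₂ = c·x₃ through e₀₁: residual conic (c+1)x₀x₁ + c·x₃(x₀+x₁); it contains e₀₁ iff c = -1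
    (∀ c x0 x1 x3 : ℤ, cayF x0 x1 (c * x3) x3 = x3 * ((c + 1) * x0 * x1 + c * x3 * (x0 + x1))) ∧
    -- on e₀₁ = {(s : t : 0 : 0)} the gradient is (0, 0, st, st): singular exactly at the two nodes st = 0
    (∀ s t : ℤ, cayD0 s t 0 0 = 0 ∧ cayD1 s t 0 0 = 0 ∧ cayD2 s t 0 0 = s * t ∧ cayD3 s t 0 0 = s * t) ∧
    -- the coordinate points are singular; a point of a simple line, e.g. (1 : -1 : 1 : -1), is smooth
    (cayD0 1 0 0 0 = 0 ∧ cayD1 1 0 0 0 = 0 ∧ cayD2 1 0 0 0 = 0 ∧ cayD3 1 0 0 0 = 0 ∧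
        cayD0 1 (-1) 1 (-1) = -1) := by
  refine ⟨?_, ?_, ?_, ?_, ?_, ?_, ?_⟩
  · intro s t; simp [cayF]
  · intro s t; refine ⟨?_, ?_, ?_, by ring⟩ <;> simp [cayF] <;> ring
  · intro x0 x1 x2; simp [cayF]; ring
  · intro x0 x1 x2; simp [cayF]
  · intro c x0 x1 x3; simp [cayF]; ring
  · intro s t; simp [cayD0, cayD1, cayD2, cayD3]
  · simp [cayD0, cayD1, cayD2, cayD3]

/-- The ℤ-linear content of the face relations: with `p_{st} = ψ(e_{st})` and the two faces
`x₃ = 0` (`p01 + p02 + p12 = k`) and `x₀ = 0` (`p12 + p13 + p23 = k`), `x₁ = 0`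
(`p02 + p03 + p23 = k`): the opposite-edge differences satisfy
`(p01 - p23) + (p02 - p13) = 0` and `(p01 - p23) - (p03 - p12) = 0`; since `2(p01 - p23) = 0`
in `JV` ((7)(i)), all three differences are EQUAL there (a formal ℤ-linear identity holds in
every abelian group). -/
theorem s5_face_relations (p01 p02 p03 p12 p13 p23 k : ℤ)
    (f3 : p01 + p02 + p12 = k) (f0 : p12 + p13 + p23 = k) (f1 : p02 + p03 + p23 = k) :
    (p01 - p23) + (p02 - p13) = 0 ∧ (p01 - p23) - (p03 - p12) = 0 := by
  constructor <;> omega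

theorem s5_theoremGamma_arith :
    -- Cayley line pattern vs the 27: three simple lines, six quadruple edges; nine lines, 11 = 4+1+6 planes
    (27 = 3 * 1 + 6 * 4) ∧ (9 = 3 + 6) ∧ (11 = 4 + 1 + 6) ∧ (45 = 1 + 6 * 2 + 4 * 8) ∧
    -- odd semiperiods and four-tangent hyperplanes [HLS Rem 2.8]: 495 = 2⁴(2⁵-1) - 1; 528 even
    (495 = 2 ^ 4 * (2 ^ 5 - 1) - 1) ∧ (528 = 2 ^ 4 * (2 ^ 5 + 1)) ∧ (495 + 528 + 1 = 1024) ∧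
    -- binodal lines = 3 per Cayley section; ordered fibre of α = 6 = 2·3; deg(γ∘α) = 432 = 6·72
    (3 * 495 = 1485) ∧ (6 * 495 = 2 * 1485) ∧ (432 = 6 * 72) ∧
    -- A-side bookkeeping at a 2-torsion x: 15 covers over 9 lines, 54 = 3·2 + 12·4 curves
    (15 = 3 + 6 * 2) ∧ (54 = 3 * 2 + 6 * 2 * 4) ∧ (24 = 6 * 4) ∧ (12 = 6 * 2) := by
  refine ⟨by norm_num, by norm_num, by norm_num, by norm_num, by norm_num, by norm_num, by norm_num,
    by norm_num, by norm_num, by norm_num, by norm_num, by norm_num, by norm_num, by norm_num⟩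

/-- (L16) PROPOSITION E9′, group orders: `|O⁻₁₀(2)| = 2·2²⁰·(2⁵+1)·∏_{i<5}(2^{2i}-1)`,
`|Sp₈(2)| = 2¹⁶·∏_{i≤4}(2^{2i}-1) = 47 377 612 800`, and the stabiliser of one of the 528
vectors with `Q = 1` has order `|O⁻₁₀(2)|/528 = 2·|Sp₈(2)|` (consistent with `2 × Sp₈(2)`);
the point-stabiliser orbit sizes in `Sp₈(2)` on `𝔽₂⁸ ∖ 0`: `255 = 1 + 126 + 128`. -/
theorem s5_E9prime_orders :
    (2 ^ 16 * ((2 ^ 2 - 1) * (2 ^ 4 - 1) * (2 ^ 6 - 1) * (2 ^ 8 - 1)) = 47377612800) ∧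
    (2 * 2 ^ 20 * (2 ^ 5 + 1) * ((2 ^ 2 - 1) * (2 ^ 4 - 1) * (2 ^ 6 - 1) * (2 ^ 8 - 1))
        = 528 * (2 * 47377612800)) ∧
    (528 = 2 ^ 4 * (2 ^ 5 + 1)) ∧ (255 = 2 ^ 8 - 1) ∧ (255 = 1 + (2 ^ 7 - 2) + 2 ^ 7) := by
  refine ⟨by norm_num, by norm_num, by norm_num, by norm_num, by norm_num⟩

end TheoremGamma

/-! ## (L17) THEOREM Σ — group orders for the monodromy argument (v1.5)
`|SO⁻₂ₙ(q)| = q^{n²-n} (q²-1)(q⁴-1)⋯(q^{2n-2}-1)(qⁿ+1)` [Malle–Testerman p.204]; for `q = 2` the full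
isometry group `O⁻₂ₙ(2)` has twice that order.  Certified below: `|O⁻₁₀(2)| = 495 · 2⁸ · |O⁻₈(2)|`
(stabiliser of one of the 495 singular vectors = `K.O⁻₈(2)` with `|K| = 2⁸`), `|O⁻₈(2)| = 2 · |Ω⁻₈(2)|`
with `|Ω⁻₈(2)| = 197 406 720`, the count `272 = 2 · (2⁷ + 2³)` of non-singular vectors orthogonal to a
singular one, and the index bookkeeping `24 = |S₄|`, `[S₄ : A₄] = 2`, `[S₄ : V₄] = 6 = |S₃|`:
a quotient of order `6` or `24` would need a composition factor of order `3`. -/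
section TheoremSigma

theorem s5_sigma_orders :
    -- |O⁻₁₀(2)| = 2 · 2^20 · (2^2-1)(2^4-1)(2^6-1)(2^8-1) · (2^5+1)
    (2 * 2 ^ 20 * ((2 ^ 2 - 1) * (2 ^ 4 - 1) * (2 ^ 6 - 1) * (2 ^ 8 - 1)) * (2 ^ 5 + 1)
        = 50030759116800) ∧
    -- |O⁻₈(2)| = 2 · 2^12 · (2^2-1)(2^4-1)(2^6-1) · (2^4+1) = 394 813 440 = 2 · |Ω⁻₈(2)|
    (2 * 2 ^ 12 * ((2 ^ 2 - 1) * (2 ^ 4 - 1) * (2 ^ 6 - 1)) * (2 ^ 4 + 1) = 394813440) ∧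
    (394813440 = 2 * 197406720) ∧
    -- stabiliser of a singular vector: |O⁻₁₀(2)| = 495 · (2^8 · |O⁻₈(2)|)
    (50030759116800 = 495 * (2 ^ 8 * 394813440)) ∧
    -- and of a non-singular one (PROP E9′): |O⁻₁₀(2)| = 528 · (2 · |Sp₈(2)|)
    (50030759116800 = 528 * (2 * 47377612800)) ∧
    -- non-singular vectors orthogonal to a singular ε: 272 = 2·(2^7 + 2^3); singular non-zero: 495
    (272 = 2 * (2 ^ 7 + 2 ^ 3)) ∧ (495 + 528 + 1 = 2 ^ 10) ∧
    -- index bookkeeping in S₄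
    (Nat.factorial 4 = 24) ∧ (24 = 2 * 12) ∧ (24 = 6 * 4) ∧ (6 = 2 * 3) := by
  refine ⟨by norm_num, by norm_num, by norm_num, by norm_num, by norm_num, by norm_num, by norm_num,
    by decide, by norm_num, by norm_num, by norm_num⟩

end TheoremSigma

end H21Scratch.TransferS5Plate
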